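import Summits.BirchSwinnertonDyer.BirchSwinnertonDyer.Theses.TangentCone
import Summits.BirchSwinnertonDyer.BirchSwinnertonDyer.Theorems.TangentConeEdgeCapArcDivisibilityTransfer
import Summits.BirchSwinnertonDyer.BirchSwinnertonDyer.Theorems.TangentConeEdgeCapInterpolantOfGS
import Summits.BirchSwinnertonDyer.BirchSwinnertonDyer.Theorems.TangentConeEdgeCapStubDeepArcGlue
import Literature.NumberTheory.EllipticCurves.PadicSeriesEvaluation

/-!
# Line `Sketch` (idea `deep-point-selmer-transport`) for crux `TangentCone.EdgeCap` (stmt-BirchSwinnertonDyer-17609) — v2 (lead c2)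

The crux-ideate sketch `20260817T063040Z-Sketch.lean` (idea card `Cruxes/EdgeCap/Ideas/deep-point-selmer-transport.md`)
made into a line skeleton. Mechanism of the card: read the arc order of the two-variable interpolant `F` off the DEEP
classical arc points only — a pointwise cap `‖F(arc t)‖ · p^(s_p (v_p(t)+1)) ≤ p^C` along ONE sequence of parameters `t`
of unbounded depth `v_p(t)` already forces `T^(s_p) ∣ F ∘ arc` (`p`-adic analysis, stub `stub_deepArcGlue`), hence the
arc bound at EVERY `t` (the ∃-form A2∃ of line `ratio_measure_strassmann` v8, with constant `C₀ = 0`), hence the crux by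
the LANDED fact-level composition `Theorems.EdgeCap_of_factsExists` (Hida members, Greenberg–Stevens/Kitagawa
interpolation, modularity ⟶ `EdgeCap`; files `TangentConeEdgeCapArcDivisibilityTransfer.lean`,
`TangentConeEdgeCapOfFacts.lean`, `TangentConeEdgeCapInterpolantOfGS.lean`).

Registered stubs (5):
* F1 `stub_hidaMembers`      — the tree named fact `hida_exists_congruent_ordinary_newform` (Hida 1986 / EPW 2005; UNPROVED in tree).
* F2 `stub_gsInterpolation`  — the tree named fact `greenbergStevens_kitagawa_twoVariable_interpolation` (GS93 Thm 5.15; UNPROVED in tree).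
* F3 `stub_modularity`       — the tree named fact `ModularForms.exists_isNewformOf` (Wiles/BCDT; UNPROVED in tree).
* G  `stub_deepArcGlue`      — ANALYSIS, LANDED p163737 (`Theorems/TangentConeEdgeCapStubDeepArcGlue.lean`, wave-1 stub worker): a deep pointwise cap along one sequence `t_m`, `v_p(t_m) → ∞`,
                               gives `‖F(arc t)‖ ≤ ‖t‖_p^s` for all `t > 0` (order of `F ∘ arc` at `T = 0` is `≥ s`).
* A  `stub_deepPointCapExists` — ARITHMETIC (the heart of the card): for admissible `(W,p)` with (Br), coprime slope and
                               members at all progression weights, SOME integral interpolant `F` (non-zero weight-2 fibre,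
                               ratio interpolation at every typed member) obeys the deep pointwise cap with `s = s_p =
                               corank Sel_p∞(E/ℚ)` along a sequence of unbounded depth. Intended proof (card): Hida depth
                               congruence `A_g(s)[p^M] ≅ E[p^M]`, transport of `(ℤ/p^M)^(s_p) ⊆ Sel_(p^M)(E)` into the
                               member's Greenberg Selmer group, Kato 2004 Thm 17.4 / EPW 2005 Thm 5.1.2 for the single
                               member, μ-rigidity for deep members.

`EdgeCap_of : F1 → F2 → F3 → G → A → EdgeCap` and `EdgeCap_proof` are sorry-free (v2: sorries only in the four open stubs F1, F2, F3, A; G closed).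
-/

set_option linter.unusedVariables false
set_option linter.dupNamespace false

noncomputable section

namespace Summit.BirchSwinnertonDyer.BirchSwinnertonDyer.Cruxes.EdgeCap.DeepPoint

open Summit.BirchSwinnertonDyer.BirchSwinnertonDyer.Theses.TangentCone

/-! ## Registered stubs -/

/-- **F1 · `stub_hidaMembers`** — classical members of the Hida branch exist at every weight `k > 2`,
`(p−1) ∣ (k−2)`: the tree named fact `Literature.NumberTheory.EllipticCurves.hida_exists_congruent_ordinary_newform`
(Hida 1986; Emerton–Pollack–Weston 2005 Thms 2.1.2/2.2.2; Hida EMI Thm 4.1.29), by name. [cite: EmertonPollackWeston2005, Thm. 2.2.2] -/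
theorem stub_hidaMembers :
    Literature.NumberTheory.EllipticCurves.hida_exists_congruent_ordinary_newform := by
  sorry

/-- **F2 · `stub_gsInterpolation`** — the Greenberg–Stevens / Kitagawa two-variable interpolation in value–norm form:
the tree named fact `Literature.NumberTheory.EllipticCurves.greenbergStevens_kitagawa_twoVariable_interpolation`
(Greenberg–Stevens 1993 Thm 5.15, Kitagawa 1994 Thm 1.1, Delbourgo 2008 Thm 4.11), by name. [cite: GreenbergStevens1993, Thm 5.15] -/
theorem stub_gsInterpolation :
    Literature.NumberTheory.EllipticCurves.greenbergStevens_kitagawa_twoVariable_interpolation := by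
  sorry

/-- **F3 · `stub_modularity`** — modularity of elliptic curves over `ℚ` (newform of level = conductor): the tree named
fact `Literature.NumberTheory.EllipticCurves.ModularForms.exists_isNewformOf` (Wiles, Taylor–Wiles,
Breuil–Conrad–Diamond–Taylor 2001 Thm A), by name. [cite: BreuilConradDiamondTaylor2001, Thm. A] -/
theorem stub_modularity :
    Literature.NumberTheory.EllipticCurves.ModularForms.exists_isNewformOf := by
  sorry

/-- **G · `stub_deepArcGlue` — a deep pointwise cap determines the arc order (`p`-adic analysis). LANDED p163737 (`Theorems.stub_deepArcGlue`).**
For an odd prime `p`, an integral `F ∈ ℚ_p⟦X, Y⟧`, exponents `a, b`, a rate `s` and a constant `C`: if for every `m`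
there is a parameter `t > 0` of depth `v_p(t) ≥ m` with `‖F((1+p)^(bt) − 1, (1+p)^(at) − 1)‖ · p^(s (v_p(t)+1)) ≤ p^C`,
then `‖F((1+p)^(bt) − 1, (1+p)^(at) − 1)‖ ≤ ‖t‖_p^s` for EVERY `t > 0`. Proof sketch: with `T_t = (1+p)^t − 1`
(`‖T_t‖ = p^(−1−v_p(t))`, lifting the exponent, tree `Theorems.stub_normCycPow`) the arc values are the values
`H(T_t)` of the integral one-variable series `H(T) = F((1+T)^b − 1, (1+T)^a − 1)` (substitution,
`padicEval₂_substPair` / `padicEval_subst`); if `H = T^e · H₁` with `H₁(0) ≠ 0` then `‖H(T_t)‖ = ‖H₁(0)‖ · ‖T_t‖^e` for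
deep `t`, so the hypothesis forces `e ≥ s` (else `‖H₁(0)‖ ≤ p^C ‖T_t‖^(s−e) → 0`); then `‖H(T_t)‖ ≤ ‖T_t‖^e ≤ ‖T_t‖^s ≤
‖t‖_p^s` for all `t > 0` (`H = 0` trivial). [folklore] -/
theorem stub_deepArcGlue :
    ∀ (p : ℕ) [Fact p.Prime], p ≠ 2 → ∀ (F : MvPowerSeries (Fin 2) ℚ_[p]),
      Literature.NumberTheory.EllipticCurves.IsPadicInt F → ∀ (a b s C : ℕ),
      (∀ m : ℕ, ∃ t : ℕ, 0 < t ∧ m ≤ padicValNat p t ∧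
        ‖Literature.NumberTheory.EllipticCurves.padicEval₂ F ((1 + (p : ℚ_[p])) ^ (b * t) - 1)
            ((1 + (p : ℚ_[p])) ^ (a * t) - 1)‖ * (p : ℝ) ^ (s * (padicValNat p t + 1)) ≤ (p : ℝ) ^ C) →
      ∀ t : ℕ, 0 < t →
        ‖Literature.NumberTheory.EllipticCurves.padicEval₂ F ((1 + (p : ℚ_[p])) ^ (b * t) - 1)
            ((1 + (p : ℚ_[p])) ^ (a * t) - 1)‖ ≤ ‖(t : ℚ_[p])‖ ^ s :=
  Summit.BirchSwinnertonDyer.BirchSwinnertonDyer.Theorems.stub_deepArcGlue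

/-- **A · `stub_deepPointCapExists` — the deep pointwise cap for ONE interpolant (ARITHMETIC; the heart of idea
`deep-point-selmer-transport`).** For admissible `(W, p)` with (Br), a coprime slope pair `a/b < 1/2` and given branch
members at all progression weights `2 + 2b(p−1)t`: there are an INTEGRAL `F ∈ ℚ_p⟦X,Y⟧` with non-zero weight-2 fibre
satisfying the ratio interpolation at every typed member (verbatim the first three clauses of A2∃ of line
`ratio_measure_strassmann` v8), and a constant `C` such that for every depth `m` SOME parameter `t > 0` with `v_p(t) ≥ m`
has `‖F((1+p)^(2b(p−1)t) − 1, (1+p)^(2a(p−1)t) − 1)‖ · p^(s_p (v_p(t)+1)) ≤ p^C`, `s_p = corank_ℤ_p Sel_p∞(E/ℚ)`.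
Intended proof (card `deep-point-selmer-transport`): depth-`M = 1+v_p(k−2)` congruence `A_(g_k)(s)[p^M] ≅ E[p^M]` on the
(Br)-isolated branch (Hida 1986 Thm II, Carayol), transport `Sel_(p^M)(E/ℚ) ⊇ (ℤ/p^M)^(s_p)` into the relaxed-at-`N`
Greenberg Selmer group of `A_(g_k)(s)`, Kato 2004 Thm 17.4 / EPW 2005 Thm 5.1.2 for the single ordinary member `g_k`,
injective control, μ-rigidity for `M > μ(X_E)`, unit Euler factors at deep points; the value identification
`‖F(x_k, y_s)‖ = |L_p^can(g_k, σ_s)|` is EPW Prop 4.1.4. None of these objects (Galois representation / Selmer group /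
canonical period of a weight-`k` newform) has a carrier in the tree today. -/
theorem stub_deepPointCapExists :
    ∀ (W : WeierstrassCurve ℚ) [W.IsElliptic] [W.IsGloballyMinimal] (_ : NeZero (W.conductorNorm ℤ)) (p : ℕ) [Fact
      p.Prime], 5 ≤ p → W.HasGoodReductionAtPrime p → ¬ (p : ℤ) ∣ W.frobeniusTrace p → ¬ (p : ℤ) ∣ (W.frobeniusTrace
      p) ^ 2 - 1 → W.HasSurjectiveModNGaloisRep p → (∀ (M : ℕ) (_ : NeZero M) (g : CuspForm
      (CongruenceSubgroup.Gamma0 M) 2) (ι : Literature.NumberTheory.EllipticCurves.ModularForms.coeffField g →+*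
      PadicAlgCl p), M ∣ W.conductorNorm ℤ * p → Literature.NumberTheory.EllipticCurves.ModularForms.IsNewform0 g →
      ‖ι ⟨(UpperHalfPlane.qExpansion 1 ⇑g).coeff p,
      Literature.NumberTheory.EllipticCurves.ModularForms.coeff_mem_coeffField g p⟩‖ = 1 → (∀ ℓ : ℕ, ℓ.Prime → ¬ ℓ ∣
      W.conductorNorm ℤ * p → ‖ι ⟨(UpperHalfPlane.qExpansion 1 ⇑g).coeff ℓ,
      Literature.NumberTheory.EllipticCurves.ModularForms.coeff_mem_coeffField g ℓ⟩ - ((W.frobeniusTrace ℓ : ℤ) :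
      PadicAlgCl p)‖ < 1) → M = W.conductorNorm ℤ ∧ ∀ n : ℕ, (UpperHalfPlane.qExpansion 1 ⇑g).coeff n =
      ((W.LFunction n : ℤ) : ℂ)) → ∀ (a b : ℕ), 0 < b → 2 * a < b → a.Coprime b → (∀ t : ℕ, 0 < t → ∃ (g : CuspForm
      (CongruenceSubgroup.Gamma0 (W.conductorNorm ℤ)) ((2 + 2 * b * (p - 1) * t : ℕ) : ℤ)) (ι :
      Literature.NumberTheory.EllipticCurves.ModularForms.coeffField g →+* PadicAlgCl p),
      Literature.NumberTheory.EllipticCurves.ModularForms.IsNewform0 g ∧ ‖ι ⟨(UpperHalfPlane.qExpansion 1 ⇑g).coeff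
      p, Literature.NumberTheory.EllipticCurves.ModularForms.coeff_mem_coeffField g p⟩‖ = 1 ∧ (∀ ℓ : ℕ, ℓ.Prime → ¬
      ℓ ∣ W.conductorNorm ℤ * p → ‖ι ⟨(UpperHalfPlane.qExpansion 1 ⇑g).coeff ℓ,
      Literature.NumberTheory.EllipticCurves.ModularForms.coeff_mem_coeffField g ℓ⟩ - ((W.frobeniusTrace ℓ : ℤ) :
      PadicAlgCl p)‖ < 1)) → ∃ F : MvPowerSeries (Fin 2) ℚ_[p], Literature.NumberTheory.EllipticCurves.IsPadicInt F
      ∧ (∃ i : ℕ, MvPowerSeries.coeff (Finsupp.single 1 i) F ≠ 0) ∧ (∀ (k : ℤ) (g : CuspForm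
      (CongruenceSubgroup.Gamma0 (W.conductorNorm ℤ)) k) (ι :
      Literature.NumberTheory.EllipticCurves.ModularForms.coeffField g →+* PadicAlgCl p) (s : ℕ), (2 * b * (p - 1) :
      ℤ) ∣ (k - 2) → (b : ℤ) * ((s : ℤ) - 1) = a * (k - 2) →
      Literature.NumberTheory.EllipticCurves.ModularForms.IsNewform0 g → ‖ι ⟨(UpperHalfPlane.qExpansion 1 ⇑g).coeff
      p, Literature.NumberTheory.EllipticCurves.ModularForms.coeff_mem_coeffField g p⟩‖ = 1 → (∀ ℓ : ℕ, ℓ.Prime → ¬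
      ℓ ∣ W.conductorNorm ℤ * p → ‖ι ⟨(UpperHalfPlane.qExpansion 1 ⇑g).coeff ℓ,
      Literature.NumberTheory.EllipticCurves.ModularForms.coeff_mem_coeffField g ℓ⟩ - ((W.frobeniusTrace ℓ : ℤ) :
      PadicAlgCl p)‖ < 1) → ∀ j : ℕ, Odd j → 3 ≤ j → (p - 1) ∣ (j - 1) → 2 * (j : ℤ) + 2 ≤ k →
      Literature.NumberTheory.EllipticCurves.padicEval₂ F ((1 + (p : ℚ_[p])) ^ (k - 2) - 1) ((1 + (p : ℚ_[p])) ^ (j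
      - 1) - 1) ≠ 0 ∧ ∀ hR : (∫ t in Set.Ioi (0 : ℝ), ((t : ℂ) ^ (s - 1)) * g (UpperHalfPlane.ofComplex ((t : ℂ) *
      Complex.I))) / (∫ t in Set.Ioi (0 : ℝ), ((t : ℂ) ^ (j - 1)) * g (UpperHalfPlane.ofComplex ((t : ℂ) *
      Complex.I))) ∈ Literature.NumberTheory.EllipticCurves.ModularForms.coeffField g, ‖ι ⟨_, hR⟩‖ *
      ‖Literature.NumberTheory.EllipticCurves.padicEval₂ F ((1 + (p : ℚ_[p])) ^ (k - 2) - 1) ((1 + (p : ℚ_[p])) ^ (j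
      - 1) - 1)‖ = ‖Literature.NumberTheory.EllipticCurves.padicEval₂ F ((1 + (p : ℚ_[p])) ^ (k - 2) - 1) ((1 + (p :
      ℚ_[p])) ^ (s - 1) - 1)‖) ∧ ∃ C : ℕ, ∀ m : ℕ, ∃ t : ℕ, 0 < t ∧ m ≤ padicValNat p t ∧
      ‖Literature.NumberTheory.EllipticCurves.padicEval₂ F ((1 + (p : ℚ_[p])) ^ (2 * b * (p - 1) * t) - 1)
          ((1 + (p : ℚ_[p])) ^ (2 * a * (p - 1) * t) - 1)‖ *
        (p : ℝ) ^ (W.selmerCorank p * (padicValNat p t + 1)) ≤ (p : ℝ) ^ C := by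
  sorry

/-! ## Stub statements by name -/

namespace Statement
/-- Statement of `stub_hidaMembers` (F1). -/
abbrev stub_hidaMembers : Prop := type_of% @DeepPoint.stub_hidaMembers
/-- Statement of `stub_gsInterpolation` (F2). -/
abbrev stub_gsInterpolation : Prop := type_of% @DeepPoint.stub_gsInterpolation
/-- Statement of `stub_modularity` (F3). -/
abbrev stub_modularity : Prop := type_of% @DeepPoint.stub_modularity
/-- Statement of `stub_deepArcGlue` (G). -/
abbrev stub_deepArcGlue : Prop := type_of% @DeepPoint.stub_deepArcGlue
/-- Statement of `stub_deepPointCapExists` (A). -/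
abbrev stub_deepPointCapExists : Prop := type_of% @DeepPoint.stub_deepPointCapExists
end Statement

/-! ## Derived: the ∃-form of the arc divisibility (A2∃ of line `ratio_measure_strassmann` v8, constant `C₀ = 0`) -/

/-- **A2∃ from G + A.** The deep pointwise cap for one interpolant and the glue give the arc bound
`‖F(arc t)‖ ≤ p^0 · ‖t‖_p^(s_p)` at every `t > 0` for the same interpolant — verbatim the hypothesis of the landed
`Theorems.EdgeCap_of_factsExists`. -/
theorem arcDivisibilityExists_of_deep (hG : Statement.stub_deepArcGlue) (hA : Statement.stub_deepPointCapExists) :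
    ∀ (W : WeierstrassCurve ℚ) [W.IsElliptic] [W.IsGloballyMinimal] (_ : NeZero (W.conductorNorm ℤ)) (p : ℕ) [Fact
      p.Prime], 5 ≤ p → W.HasGoodReductionAtPrime p → ¬ (p : ℤ) ∣ W.frobeniusTrace p → ¬ (p : ℤ) ∣ (W.frobeniusTrace
      p) ^ 2 - 1 → W.HasSurjectiveModNGaloisRep p → (∀ (M : ℕ) (_ : NeZero M) (g : CuspForm
      (CongruenceSubgroup.Gamma0 M) 2) (ι : Literature.NumberTheory.EllipticCurves.ModularForms.coeffField g →+*
      PadicAlgCl p), M ∣ W.conductorNorm ℤ * p → Literature.NumberTheory.EllipticCurves.ModularForms.IsNewform0 g →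
      ‖ι ⟨(UpperHalfPlane.qExpansion 1 ⇑g).coeff p,
      Literature.NumberTheory.EllipticCurves.ModularForms.coeff_mem_coeffField g p⟩‖ = 1 → (∀ ℓ : ℕ, ℓ.Prime → ¬ ℓ ∣
      W.conductorNorm ℤ * p → ‖ι ⟨(UpperHalfPlane.qExpansion 1 ⇑g).coeff ℓ,
      Literature.NumberTheory.EllipticCurves.ModularForms.coeff_mem_coeffField g ℓ⟩ - ((W.frobeniusTrace ℓ : ℤ) :
      PadicAlgCl p)‖ < 1) → M = W.conductorNorm ℤ ∧ ∀ n : ℕ, (UpperHalfPlane.qExpansion 1 ⇑g).coeff n =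
      ((W.LFunction n : ℤ) : ℂ)) → ∀ (a b : ℕ), 0 < b → 2 * a < b → a.Coprime b → (∀ t : ℕ, 0 < t → ∃ (g : CuspForm
      (CongruenceSubgroup.Gamma0 (W.conductorNorm ℤ)) ((2 + 2 * b * (p - 1) * t : ℕ) : ℤ)) (ι :
      Literature.NumberTheory.EllipticCurves.ModularForms.coeffField g →+* PadicAlgCl p),
      Literature.NumberTheory.EllipticCurves.ModularForms.IsNewform0 g ∧ ‖ι ⟨(UpperHalfPlane.qExpansion 1 ⇑g).coeff
      p, Literature.NumberTheory.EllipticCurves.ModularForms.coeff_mem_coeffField g p⟩‖ = 1 ∧ (∀ ℓ : ℕ, ℓ.Prime → ¬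
      ℓ ∣ W.conductorNorm ℤ * p → ‖ι ⟨(UpperHalfPlane.qExpansion 1 ⇑g).coeff ℓ,
      Literature.NumberTheory.EllipticCurves.ModularForms.coeff_mem_coeffField g ℓ⟩ - ((W.frobeniusTrace ℓ : ℤ) :
      PadicAlgCl p)‖ < 1)) → ∃ F : MvPowerSeries (Fin 2) ℚ_[p], Literature.NumberTheory.EllipticCurves.IsPadicInt F
      ∧ (∃ i : ℕ, MvPowerSeries.coeff (Finsupp.single 1 i) F ≠ 0) ∧ (∀ (k : ℤ) (g : CuspForm
      (CongruenceSubgroup.Gamma0 (W.conductorNorm ℤ)) k) (ι :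
      Literature.NumberTheory.EllipticCurves.ModularForms.coeffField g →+* PadicAlgCl p) (s : ℕ), (2 * b * (p - 1) :
      ℤ) ∣ (k - 2) → (b : ℤ) * ((s : ℤ) - 1) = a * (k - 2) →
      Literature.NumberTheory.EllipticCurves.ModularForms.IsNewform0 g → ‖ι ⟨(UpperHalfPlane.qExpansion 1 ⇑g).coeff
      p, Literature.NumberTheory.EllipticCurves.ModularForms.coeff_mem_coeffField g p⟩‖ = 1 → (∀ ℓ : ℕ, ℓ.Prime → ¬
      ℓ ∣ W.conductorNorm ℤ * p → ‖ι ⟨(UpperHalfPlane.qExpansion 1 ⇑g).coeff ℓ,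
      Literature.NumberTheory.EllipticCurves.ModularForms.coeff_mem_coeffField g ℓ⟩ - ((W.frobeniusTrace ℓ : ℤ) :
      PadicAlgCl p)‖ < 1) → ∀ j : ℕ, Odd j → 3 ≤ j → (p - 1) ∣ (j - 1) → 2 * (j : ℤ) + 2 ≤ k →
      Literature.NumberTheory.EllipticCurves.padicEval₂ F ((1 + (p : ℚ_[p])) ^ (k - 2) - 1) ((1 + (p : ℚ_[p])) ^ (j
      - 1) - 1) ≠ 0 ∧ ∀ hR : (∫ t in Set.Ioi (0 : ℝ), ((t : ℂ) ^ (s - 1)) * g (UpperHalfPlane.ofComplex ((t : ℂ) *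
      Complex.I))) / (∫ t in Set.Ioi (0 : ℝ), ((t : ℂ) ^ (j - 1)) * g (UpperHalfPlane.ofComplex ((t : ℂ) *
      Complex.I))) ∈ Literature.NumberTheory.EllipticCurves.ModularForms.coeffField g, ‖ι ⟨_, hR⟩‖ *
      ‖Literature.NumberTheory.EllipticCurves.padicEval₂ F ((1 + (p : ℚ_[p])) ^ (k - 2) - 1) ((1 + (p : ℚ_[p])) ^ (j
      - 1) - 1)‖ = ‖Literature.NumberTheory.EllipticCurves.padicEval₂ F ((1 + (p : ℚ_[p])) ^ (k - 2) - 1) ((1 + (p :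
      ℚ_[p])) ^ (s - 1) - 1)‖) ∧ ∃ C₀ : ℕ, ∀ t : ℕ, 0 < t → ‖Literature.NumberTheory.EllipticCurves.padicEval₂ F ((1
      + (p : ℚ_[p])) ^ (2 * b * (p - 1) * t) - 1) ((1 + (p : ℚ_[p])) ^ (2 * a * (p - 1) * t) - 1)‖ ≤ (p : ℝ) ^ C₀ *
      ‖(t : ℚ_[p])‖ ^ W.selmerCorank p := by
  intro W _ _ hN p _ hp5 hgood hord hanom hsurj hBr a b hb hab hcop hmem
  obtain ⟨F, hFi, hwt, hinterp, C, hdeep⟩ := hA W hN p hp5 hgood hord hanom hsurj hBr a b hb hab hcop hmem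
  refine ⟨F, hFi, hwt, hinterp, 0, fun t ht => ?_⟩
  have hp2 : p ≠ 2 := by omega
  have key := hG p hp2 F hFi (2 * a * (p - 1)) (2 * b * (p - 1)) (W.selmerCorank p) C hdeep t ht
  simpa using key

/-! ## The composition (sorry-free) -/

/-- **`EdgeCap_of`** — the five stub STATEMENTS imply the crux `TangentCone.EdgeCap`, BY NAME: A2∃ from G + A
(`arcDivisibilityExists_of_deep`), then the landed fact-level composition `Theorems.EdgeCap_of_factsExists`
(transfer to every interpolant, content division, fibre Strassmann, uniform reference, the ratio identity, the depth
dichotomy). Axioms: propext, Classical.choice, Quot.sound. -/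
theorem EdgeCap_of (h1 : Statement.stub_hidaMembers) (h2 : Statement.stub_gsInterpolation)
    (h3 : Statement.stub_modularity) (hG : Statement.stub_deepArcGlue)
    (hA : Statement.stub_deepPointCapExists) : EdgeCap :=
  Summit.BirchSwinnertonDyer.BirchSwinnertonDyer.Theorems.EdgeCap_of_factsExists h1 h2 h3
    (arcDivisibilityExists_of_deep hG hA)

/-- The crux along this line, MODULO the registered stubs (F1, F2, F3, G, A). -/
theorem EdgeCap_proof : EdgeCap :=
  EdgeCap_of stub_hidaMembers stub_gsInterpolation stub_modularity stub_deepArcGlue stub_deepPointCapExists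

end Summit.BirchSwinnertonDyer.BirchSwinnertonDyer.Cruxes.EdgeCap.DeepPoint

end
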